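import Summits.HodgeConjecture.HodgeConjecture.Theorems.F0P3bCharDistReduction        -- ★ the CM local carriers `H_v`, `G′_v` with their non-archimedean structure; `IsLocSmooth`, `IsLocalDeltaTransfer`, `IrrClass.smoothTrace`
import Literature.NumberTheory.Rogawski1990.FinExplicitTransferFactorConjRight              -- ★ `finExplicitCollection`, `finExplicitDelta_conj_left_all ∕ _right_all` (the transfer factor of record `Δ‴_v`)
import HarnessLib

/-!
# R90 · S3 · hand p04 «A1-sqInt» (FILE D type T5 «rest») — the COMPOSITION, WITNESS-THREADED FORM (dealer ruling (iii)(β) 16:12:57Z ∕ 16:14:19Z):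
# ONE countable integer expansion of `Tr ρ(f^H)` whose non-zero coefficients are finitely many IS an endoscopic expansion in the sense of socket A1

Companion of ★ `Theorems/R90S3EndoExpansionOfCountableExpansion.lean` (p861796, `endoExpansion_exists_of_countableExpansion_of_finite`, hypotheses `hE` +
UNIVERSAL `hfin`).  The S3 dealer's ruling (iii) (R90 bus 16:12:57Z, 16:14:19Z): the universal finiteness «ANY countable summable ℤ-expansion of `Tr ρ` is finitely
supported» is print-true only as Lemma 12.7.2 (i) PLUS uniqueness of summable character expansions (uniform admissibility [Bernstein] ∕ linear independence
of characters) — stronger than what p. 218–219 uses, which applies Lemma 12.7.2 to THE expansion delivered by (13.8.3).  Option (β) «thread the witness»: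
ONE hypothesis `hEfin` = «there is a countable integer expansion `(X, a)` of `Tr ρ(f^H)` on `Δ‴_v`-matched smooth pairs [(13.8.3) read at `v`, §13.8
pp. 218–219 + the globalisation, Langlands1980 p. 227] AND its non-zero coefficients are finitely many [Lemma 12.7.2 (i) applied to it, §12.7 pp. 191–192]».
This file proves the T5 clause of A1 from `hEfin` (same glue: `c := a·𝟙_X` as a `Finsupp`, `tsum_subtype` + `tsum_eq_sum`), so that FILE E may type
E-T5 in EITHER form and D ED. 2 pays `stub_R90_S3_endoExpansion_rest` by `exact` from the matching ★ theorem — no adapter needed.  R90-TF SLAB (brief v2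
1f40d54518340a35), section S3, dealer R90-C12-plan (g0), DEAL `R90/S3/DEAL-S3-WAVE1.R90-C12-plan-g0.md` 708593ee hand p04; seat R90-C14-p04 (g0); ROAD memo
`R90/R90-C14-p04/g0/ROAD-A1-sqInt.md` de53f0f8efe3437e.  THEOREMS ONLY (one public theorem; no `def`, no instance, no notation, no `sorry`); Lines-free
(`IsEndoExpansion` of `Lines/R90_S3_EndoFibreDefsC` :65 UNFOLDED token for token in the conclusion); lane `--supports stmt-HodgeConjecture-24833 --as helper`.
HONEST LABEL: HC_CM is proved only modulo the 7 printed citations (2 remaining named inputs: hLiu418 = stmt-HodgeConjecture-24832, h413 = stmt-HodgeConjecture-24833)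
until rung 0 closes; this file proves the T5 clause of A1 CONDITIONALLY on the printed input E-T5 ((13.8.3) at `v` + Lemma 12.7.2 (i)), which is NOT in the tree;
REL ≠ ★ ≠ BUILT.

## References
* [Rogawski1990] J. D. Rogawski, *Automorphic Representations of Unitary Groups in Three Variables*, Ann. of Math. Stud. 123 (1990): §13.1 Thm. 13.1.1 (2)
  p. 198; §13.8 Props. 13.8.1–13.8.3 pp. 216–219 (display (13.8.3)); §12.7 Lemma 12.7.2 pp. 191–192; §4.9 p. 55.
* [Langlands1980] R. P. Langlands, *Base change for GL(2)*, Ann. of Math. Stud. 96 (1980), p. 227; pp. 208–211.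
-/

set_option autoImplicit false
-- the mandated namespace repeats the single-problem summit's segment (`HodgeConjecture.HodgeConjecture`)
set_option linter.dupNamespace false

noncomputable section

namespace Summit.HodgeConjecture.HodgeConjecture.R90.S3

open MeasureTheory IsDedekindDomain NumberField
open Literature.NumberTheory Literature.NumberTheory.Automorphic Literature.NumberTheory.Automorphic.UnitaryGroup
open Literature.NumberTheory.Rogawski1990 Literature.NumberTheory.GaloisRepresentations
open scoped Matrix

variable (L : Type) [Field L] [NumberField L] [IsCMField L] (H' : Matrix (Fin 3) (Fin 3) L)
  (v : HeightOneSpectrum (𝓞 ↥(maximalRealSubfield L)))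

/-- **A1 from ONE finitely supported countable integer expansion (FILE D type T5 «rest», witness-threaded form of the two printed inputs).**
At the record local data of socket A1, let `ρ` be a finite set of classes of `H_v`.  IF there are a countable set `X` of classes of `G′_v` and integers
`a(π)` such that (E-T5a, print's (13.8.3) read at `v` [Rogawski1990 §13.8 pp. 218–219]) `Σ_{π∈X} a(π)·Tr π(f) = Σ_{σ∈ρ} Tr σ(f^H)` (absolutely convergent)
for every `Δ‴_v`-matched pair of smooth `(f^H, f)` AND (E-T5b, Lemma 12.7.2 (i) applied to THIS expansion [§12.7 pp. 191–192]) only finitely many `π ∈ X`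
have `a(π) ≠ 0`, THEN `ρ` has an endoscopic expansion with integer coefficients: a finitely supported `c : IrrClass G′_v →₀ ℤ` with
`Σ_{σ∈ρ} Tr σ(f^H) = Σ_{π ∈ c.support} c(π)·Tr π(f)` on every matched pair (the conclusion of A1 ∕ the body of `R90.S3.IsEndoExpansion`, token for token).
[cite: Rogawski1990, §13.1 Thm. 13.1.1 (2) p. 198; §13.8 Prop. 13.8.3 pp. 218–219; §12.7 Lemma 12.7.2 pp. 191–192] [cite: Langlands1980, p. 227] -/
theorem endoExpansion_exists_of_finite_countableExpansion
    (μ : HeckeCharacter L)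
    [MeasurableSpace ((UnitaryGroup.cmDatum L 3 H').Local v)] [BorelSpace ((UnitaryGroup.cmDatum L 3 H').Local v)]
    [MeasurableSpace ((UnitaryGroup.cmDatum L 2 (Matrix.of fun i j : Fin 2 => if i.val + j.val + 1 = 2 then (1 : L) else 0)).Local v ×
      (UnitaryGroup.cmDatum L 1 (Matrix.of fun i j : Fin 1 => if i.val + j.val + 1 = 1 then (1 : L) else 0)).Local v)]
    [BorelSpace ((UnitaryGroup.cmDatum L 2 (Matrix.of fun i j : Fin 2 => if i.val + j.val + 1 = 2 then (1 : L) else 0)).Local v ×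
      (UnitaryGroup.cmDatum L 1 (Matrix.of fun i j : Fin 1 => if i.val + j.val + 1 = 1 then (1 : L) else 0)).Local v)]
    [∀ a : ((UnitaryGroup.cmDatum L 2 (Matrix.of fun i j : Fin 2 => if i.val + j.val + 1 = 2 then (1 : L) else 0)).Local v ×
      (UnitaryGroup.cmDatum L 1 (Matrix.of fun i j : Fin 1 => if i.val + j.val + 1 = 1 then (1 : L) else 0)).Local v),
      MeasurableSpace (((UnitaryGroup.cmDatum L 2 (Matrix.of fun i j : Fin 2 => if i.val + j.val + 1 = 2 then (1 : L) else 0)).Local v ×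
      (UnitaryGroup.cmDatum L 1 (Matrix.of fun i j : Fin 1 => if i.val + j.val + 1 = 1 then (1 : L) else 0)).Local v) ⧸
        Subgroup.centralizer ({a} : Set ((UnitaryGroup.cmDatum L 2 (Matrix.of fun i j : Fin 2 => if i.val + j.val + 1 = 2 then (1 : L) else 0)).Local v ×
      (UnitaryGroup.cmDatum L 1 (Matrix.of fun i j : Fin 1 => if i.val + j.val + 1 = 1 then (1 : L) else 0)).Local v)))]
    [∀ a : ((UnitaryGroup.cmDatum L 2 (Matrix.of fun i j : Fin 2 => if i.val + j.val + 1 = 2 then (1 : L) else 0)).Local v ×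
      (UnitaryGroup.cmDatum L 1 (Matrix.of fun i j : Fin 1 => if i.val + j.val + 1 = 1 then (1 : L) else 0)).Local v),
      BorelSpace (((UnitaryGroup.cmDatum L 2 (Matrix.of fun i j : Fin 2 => if i.val + j.val + 1 = 2 then (1 : L) else 0)).Local v ×
      (UnitaryGroup.cmDatum L 1 (Matrix.of fun i j : Fin 1 => if i.val + j.val + 1 = 1 then (1 : L) else 0)).Local v) ⧸
        Subgroup.centralizer ({a} : Set ((UnitaryGroup.cmDatum L 2 (Matrix.of fun i j : Fin 2 => if i.val + j.val + 1 = 2 then (1 : L) else 0)).Local v ×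
      (UnitaryGroup.cmDatum L 1 (Matrix.of fun i j : Fin 1 => if i.val + j.val + 1 = 1 then (1 : L) else 0)).Local v)))]
    [∀ γ : ((UnitaryGroup.cmDatum L 3 H').Local v), MeasurableSpace (((UnitaryGroup.cmDatum L 3 H').Local v) ⧸ Subgroup.centralizer ({γ} : Set ((UnitaryGroup.cmDatum L 3 H').Local v)))]
    [∀ γ : ((UnitaryGroup.cmDatum L 3 H').Local v), BorelSpace (((UnitaryGroup.cmDatum L 3 H').Local v) ⧸ Subgroup.centralizer ({γ} : Set ((UnitaryGroup.cmDatum L 3 H').Local v)))]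
    (νG : Measure ((UnitaryGroup.cmDatum L 3 H').Local v)) [νG.IsHaarMeasure] [νG.IsMulRightInvariant]
    (νH : Measure ((UnitaryGroup.cmDatum L 2 (Matrix.of fun i j : Fin 2 => if i.val + j.val + 1 = 2 then (1 : L) else 0)).Local v ×
      (UnitaryGroup.cmDatum L 1 (Matrix.of fun i j : Fin 1 => if i.val + j.val + 1 = 1 then (1 : L) else 0)).Local v))
    [νH.IsHaarMeasure] [νH.IsMulRightInvariant]
    (mH : OrbitalMeasureFamily ((UnitaryGroup.cmDatum L 2 (Matrix.of fun i j : Fin 2 => if i.val + j.val + 1 = 2 then (1 : L) else 0)).Local v ×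
      (UnitaryGroup.cmDatum L 1 (Matrix.of fun i j : Fin 1 => if i.val + j.val + 1 = 1 then (1 : L) else 0)).Local v))
    (mG : OrbitalMeasureFamily ((UnitaryGroup.cmDatum L 3 H').Local v))
    (ρ : Finset (IrrClass ((UnitaryGroup.cmDatum L 2 (Matrix.of fun i j : Fin 2 => if i.val + j.val + 1 = 2 then (1 : L) else 0)).Local v ×
      (UnitaryGroup.cmDatum L 1 (Matrix.of fun i j : Fin 1 => if i.val + j.val + 1 = 1 then (1 : L) else 0)).Local v)))
    (hEfin : ∃ (X : Set (IrrClass ((UnitaryGroup.cmDatum L 3 H').Local v))) (a : IrrClass ((UnitaryGroup.cmDatum L 3 H').Local v) → ℤ),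
        X.Countable ∧
        (∀ (fH : (UnitaryGroup.cmDatum L 2 (Matrix.of fun i j : Fin 2 => if i.val + j.val + 1 = 2 then (1 : L) else 0)).Local v ×
        (UnitaryGroup.cmDatum L 1 (Matrix.of fun i j : Fin 1 => if i.val + j.val + 1 = 1 then (1 : L) else 0)).Local v → ℂ)
          (f : (UnitaryGroup.cmDatum L 3 H').Local v → ℂ),
          IsLocSmooth fH → IsLocSmooth f →
            IsLocalDeltaTransfer L H' v
              (finExplicitCollection L H' μ (finExplicitDelta_conj_left_all L H' μ) (finExplicitDelta_conj_right_all L H' μ) v) mH mG fH f →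
            Summable (fun π : X => (a π : ℂ) * (π : IrrClass ((UnitaryGroup.cmDatum L 3 H').Local v)).smoothTrace νG f) ∧
              ∑' π : X, (a π : ℂ) * (π : IrrClass ((UnitaryGroup.cmDatum L 3 H').Local v)).smoothTrace νG f = ∑ σ ∈ ρ, σ.smoothTrace νH fH) ∧
        {π | π ∈ X ∧ a π ≠ 0}.Finite) :
    ∃ c : IrrClass ((UnitaryGroup.cmDatum L 3 H').Local v) →₀ ℤ,
      ∀ (fH : (UnitaryGroup.cmDatum L 2 (Matrix.of fun i j : Fin 2 => if i.val + j.val + 1 = 2 then (1 : L) else 0)).Local v ×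
        (UnitaryGroup.cmDatum L 1 (Matrix.of fun i j : Fin 1 => if i.val + j.val + 1 = 1 then (1 : L) else 0)).Local v → ℂ)
        (f : (UnitaryGroup.cmDatum L 3 H').Local v → ℂ),
        IsLocSmooth fH → IsLocSmooth f →
          IsLocalDeltaTransfer L H' v
            (finExplicitCollection L H' μ (finExplicitDelta_conj_left_all L H' μ) (finExplicitDelta_conj_right_all L H' μ) v) mH mG fH f →
          ∑ σ ∈ ρ, σ.smoothTrace νH fH = ∑ π ∈ c.support, (c π : ℂ) * π.smoothTrace νG f := by
  classical
  obtain ⟨X, a, -, hid, hF⟩ := hEfin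
  -- the coefficient function of record: `a` cut off to `X`, a `Finsupp` by `hF`
  have hsupp : (Function.support (X.indicator a)).Finite := by
    refine hF.subset fun π hπ => ?_
    rw [Function.mem_support, Set.indicator_apply_ne_zero, Set.mem_inter_iff, Function.mem_support] at hπ
    exact hπ
  refine ⟨Finsupp.ofSupportFinite (X.indicator a) hsupp, fun fH f hfH hf hΔ => ?_⟩
  obtain ⟨-, heq⟩ := hid fH f hfH hf hΔ
  rw [← heq]
  -- the countable sum over `X` is the sum of the `X`-cut-off family over all classes …
  have h1 : ∑' π : X, (a π : ℂ) * (π : IrrClass ((UnitaryGroup.cmDatum L 3 H').Local v)).smoothTrace νG f =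
      ∑' π, X.indicator (fun π => (a π : ℂ) * π.smoothTrace νG f) π :=
    tsum_subtype X (fun π => (a π : ℂ) * π.smoothTrace νG f)
  -- … whose terms are `c(π) · Tr π(f)` …
  have h2 : ∀ π, X.indicator (fun π => (a π : ℂ) * π.smoothTrace νG f) π =
      ((Finsupp.ofSupportFinite (X.indicator a) hsupp π : ℤ) : ℂ) * π.smoothTrace νG f := by
    intro π
    rw [Finsupp.ofSupportFinite_coe]
    by_cases hπ : π ∈ X
    · rw [Set.indicator_of_mem hπ, Set.indicator_of_mem hπ]
    · rw [Set.indicator_of_notMem hπ, Set.indicator_of_notMem hπ, Int.cast_zero, zero_mul]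
  rw [h1, tsum_congr h2]
  -- … and vanish off the finite support, so the series is the finite sum
  exact tsum_eq_sum fun π hπ => by
    rw [Finsupp.notMem_support_iff.1 hπ, Int.cast_zero, zero_mul]

end Summit.HodgeConjecture.HodgeConjecture.R90.S3

end
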